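import Literature.AlgebraicGeometry.Resolution.RsopAdaptedShift
import Literature.AlgebraicGeometry.Resolution.HironakaTauScheme
import Literature.AlgebraicGeometry.Resolution.RegularSystemOfParameters
import HarnessLib

/-!
# Coordinates adapted at two indices: `τ(x) = 1` ⇒ `T_x = k(x)·Y_{j₀}` for a regular system of parameters
# (CoP1, proof of Lemma 4.3 (5): "we may now choose `(y₁, y₂, y₃)` in such a way that `T_x = k(x).Y₃`")

Topic: `Literature/AlgebraicGeometry/Resolution`. [CoP1] = Cossart–Piltant, J. Algebra 320 (2008) 1051–1082, proof of Lemma 4.3 (5), p. 9: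
"To prove (5), we may now choose `(y₁, y₂, y₃)` in such a way that `T_x = k(x).Y₃`." The tree's chart statements of Lemma 4.3 (5)
(`NearPointsPointCentreLine.lean`, `NearPointsPointCentreLineLocal.lean`: near points over a `τ = 1` point lie on the line
`L_x = {Y_{j₀} = 0}` and the line is a regular curve germ there) take as HYPOTHESIS a regular system of parameters `c` ADAPTED at every
index `i ≠ j₀` (`IsAdapted c J μ i`: the directrix kills `e_i`, `RsopAdaptedShift.lean`), i.e. `T = k·Y_{j₀}`. PROVED here, the existence
of such coordinates (no definitions, no facts):

* `exists_isAdapted_pair_of_two_le_finrank` — in a regular local ring with a regular system of parameters `c`, if the invariance space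
  `𝕎(cl_μ^{c} J)` has dimension `≥ 2` then two successive shears (`shiftRsop`, tree `isAdapted_shiftRsop`; the second shear fixes
  `e_{i₁}`, so it keeps the first adaptedness) produce a regular system of parameters adapted at two distinct indices;
* `exists_forall_ne_isAdapted_of_hironakaTauAt_eq_one` — embedding dimension `3`, `τ = 1`: a regular system of parameters adapted at
  both indices `≠ j₀`;
* `exists_rsop_forall_ne_isAdapted_of_stalkTau_eq_one` — the same at a point `x` of a scheme with `𝒪_{X,x}` regular of embedding
  dimension `3` and `τ_x(J, μ) = 1` (the `had` input of `IsBlowup.exists_isRsopPart_line_of_isNear_point_of_stalkTau_eq_one`).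

Cell res-hironaka, F-71 census row ρ1 (`pointStep_curves`) / S3 (STEP-P): the coordinate choice both need.

## Sources

* V. Cossart, O. Piltant, J. Algebra 320 (2008) 1051–1082, proof of Lemma 4.3 (5), p. 9; proof of Lemma 4.3 (3), p. 8. [CossartPiltant2008]
-/

noncomputable section

open IsLocalRing MvPolynomial

namespace Literature.AlgebraicGeometry.Resolution

universe u

/-- In `Fin 3` there is an index different from two given ones. [folklore] -/
private theorem Fin.exists_ne_and_ne_three (i₁ i₂ : Fin 3) : ∃ j₀ : Fin 3, j₀ ≠ i₁ ∧ j₀ ≠ i₂ := by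
  revert i₁ i₂; decide

/-- In `Fin 3`, an index different from the third of three pairwise constraints is one of the other two. [folklore] -/
private theorem Fin.eq_or_eq_of_ne_three {i i₁ i₂ j₀ : Fin 3} (hne : i₁ ≠ i₂) (h₁ : j₀ ≠ i₁) (h₂ : j₀ ≠ i₂)
    (hi : i ≠ j₀) : i = i₁ ∨ i = i₂ := by
  revert i i₁ i₂ j₀; decide

section Regular

variable {R : Type u} [CommRing R] [IsRegularLocalRing R] {d : ℕ} (hd : (maximalIdeal R).spanFinrank = d)
  {c : Fin d → R} (hc : Ideal.span (Set.range c) = maximalIdeal R)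

include hd hc in
/-- **A shear at `j` keeps adaptedness at every other index `i`** (the transition matrix `1 + E` of the shear fixes `e_i`, `i ≠ j`).
[cite: CossartPiltant2008, Lemma 4.3 (3) (proof)] -/
theorem IsAdapted.shiftRsop_of_ne {J : Ideal R} {μ : ℕ} {i : Fin d} (had : IsAdapted c J μ i) (j : Fin d) (hij : i ≠ j)
    (a : {l : Fin d // l ≠ j} → R) : IsAdapted (shiftRsop c j a) J μ i := by
  classical
  have hc₂ : Ideal.span (Set.range (shiftRsop c j a)) = maximalIdeal R := by
    rw [span_range_shiftRsop, hc]
  have key := initialForms_eq_image_linSubst hd hc₂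
    (eq_sum_one_add_shiftMatrix_mul (c := c) j a)
    (shiftRsop_eq_sum_one_sub_shiftMatrix_mul (c := c) j a) J μ
  have hAB := map_residue_transition_mul_eq_one hd hc
    (eq_sum_one_add_shiftMatrix_mul (c := c) j a)
    (shiftRsop_eq_sum_one_sub_shiftMatrix_mul (c := c) j a)
  -- `(1 + Ē) e_i = e_i`
  have hfix : ((1 + shiftMatrix j a).map (residue R)).mulVec (Pi.single i 1) = Pi.single i 1 := by
    ext l
    rw [Matrix.mulVec_single_one, Matrix.col_apply, Matrix.map_apply, Matrix.add_apply]
    have hE : shiftMatrix j a l i = 0 := by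
      simp only [shiftMatrix, Matrix.of_apply]
      by_cases h : l = j
      · rw [dif_pos h]
      · rw [dif_neg h, if_neg (Ne.symm hij).symm]
    rw [hE, add_zero, Matrix.one_apply, Pi.single_apply]
    by_cases h : l = i
    · subst h; simp
    · rw [if_neg h, if_neg h, map_zero]
  unfold IsAdapted at had ⊢
  rw [key, invarianceSpace_image_linSubst (ResidueField R) hAB, Submodule.mem_comap, Matrix.toLin'_apply, hfix]
  exact had

include hd hc in
/-- The dimension of the invariance space `𝕎(cl_μ^{c} J)` does not depend on the regular system of parameters (it is `d − τ`).
[cite: CossartPiltant2008, proof of Prop. 4.2] -/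
theorem finrank_invarianceSpace_eq_of_rsop {c' : Fin d → R} (hc' : Ideal.span (Set.range c') = maximalIdeal R)
    (J : Ideal R) (μ : ℕ) :
    Module.finrank (ResidueField R) (invarianceSpace (ResidueField R)
        (initialForms c' J μ : Set (MvPolynomial (Fin d) (ResidueField R)))) =
      Module.finrank (ResidueField R) (invarianceSpace (ResidueField R)
        (initialForms c J μ : Set (MvPolynomial (Fin d) (ResidueField R)))) := by
  have h1 := hironakaTau_add_finrank_invarianceSpace (ResidueField R)
    (initialForms c' J μ : Set (MvPolynomial (Fin d) (ResidueField R)))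
  have h2 := hironakaTau_add_finrank_invarianceSpace (ResidueField R)
    (initialForms c J μ : Set (MvPolynomial (Fin d) (ResidueField R)))
  have h3 : hironakaTauAt c' J μ = hironakaTauAt c J μ := hironakaTauAt_eq_of_rsop hd hc hc' J μ
  unfold hironakaTauAt at h3
  omega

include hd hc in
/-- **Two shears give a regular system of parameters adapted at two distinct indices** when `dim 𝕎(cl_μ J) ≥ 2`: shear at an index
`i₁` carrying a non-zero vector of `𝕎` (`exists_isAdapted_of_ne_bot`), then at an index `i₂ ≠ i₁` carrying a vector of the new `𝕎`
with vanishing `i₁`-coordinate; the second shear keeps the first adaptedness (`IsAdapted.shiftRsop_of_ne`).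
[cite: CossartPiltant2008, Lemma 4.3 (5) (proof)] -/
theorem exists_isAdapted_pair_of_two_le_finrank {J : Ideal R} {μ : ℕ}
    (hW : 2 ≤ Module.finrank (ResidueField R) (invarianceSpace (ResidueField R)
      (initialForms c J μ : Set (MvPolynomial (Fin d) (ResidueField R))))) :
    ∃ (c' : Fin d → R) (i₁ i₂ : Fin d), Ideal.span (Set.range c') = maximalIdeal R ∧ i₁ ≠ i₂ ∧
      IsAdapted c' J μ i₁ ∧ IsAdapted c' J μ i₂ := by
  classical
  set k := ResidueField R
  -- first shear
  have hW0 : invarianceSpace k (initialForms c J μ : Set (MvPolynomial (Fin d) k)) ≠ ⊥ := by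
    intro h
    rw [h, finrank_bot] at hW
    omega
  obtain ⟨i₁, a, had₁⟩ := exists_isAdapted_of_ne_bot hd hc hW0
  set c₁ := shiftRsop c i₁ a with hc₁def
  have hc₁ : Ideal.span (Set.range c₁) = maximalIdeal R := by rw [hc₁def, span_range_shiftRsop, hc]
  set W₁ := invarianceSpace k (initialForms c₁ J μ : Set (MvPolynomial (Fin d) k)) with hW₁def
  have he₁ : (Pi.single i₁ 1 : Fin d → k) ∈ W₁ := had₁
  have hW₁ : 2 ≤ Module.finrank k W₁ := by
    rw [hW₁def, finrank_invarianceSpace_eq_of_rsop hd hc hc₁ J μ]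
    exact hW
  -- a vector of `W₁` off the line `k e_{i₁}`
  obtain ⟨v, hvW, hvspan⟩ : ∃ v ∈ W₁, v ∉ (k ∙ (Pi.single i₁ 1 : Fin d → k)) := by
    by_contra h
    push Not at h
    have hle : W₁ ≤ k ∙ (Pi.single i₁ 1 : Fin d → k) := fun v hv => h v hv
    have hne0 : (Pi.single i₁ 1 : Fin d → k) ≠ 0 := fun h => by
      have := congr_fun h i₁
      simp at this
    have h1 : Module.finrank k W₁ ≤ 1 :=
      (Submodule.finrank_mono hle).trans (finrank_span_singleton hne0).le
    omega
  set v' : Fin d → k := v - v i₁ • (Pi.single i₁ 1 : Fin d → k) with hv'def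
  have hv'W : v' ∈ W₁ := W₁.sub_mem hvW (W₁.smul_mem _ he₁)
  have hv'i₁ : v' i₁ = 0 := by simp [hv'def]
  have hv'0 : v' ≠ 0 := by
    intro h0
    apply hvspan
    have : v = v i₁ • (Pi.single i₁ 1 : Fin d → k) := by
      rw [← sub_eq_zero, ← hv'def]; exact h0
    rw [this]
    exact Submodule.smul_mem _ _ (Submodule.mem_span_singleton_self _)
  obtain ⟨i₂, hi₂⟩ : ∃ i, v' i ≠ 0 := by
    by_contra h
    push Not at h
    exact hv'0 (funext h)
  have hi₁₂ : i₁ ≠ i₂ := by rintro rfl; exact hi₂ hv'i₁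
  -- normalise and lift: the second shear vector `u`, `u_{i₂} = 1`, `u_{i₁} = 0`
  set u : Fin d → k := (v' i₂)⁻¹ • v' with hudef
  have huW : u ∈ W₁ := W₁.smul_mem _ hv'W
  have hui₂ : u i₂ = 1 := by
    simp only [hudef, Pi.smul_apply, smul_eq_mul]
    exact inv_mul_cancel₀ hi₂
  obtain ⟨a', ha'⟩ : ∃ a' : {i : Fin d // i ≠ i₂} → R, ∀ i, residue R (a' i) = u i.1 :=
    ⟨fun i => Classical.choose (residue_surjective (u i.1)),
      fun i => Classical.choose_spec (residue_surjective (u i.1))⟩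
  have hu : (fun i => if h : i = i₂ then (1 : k) else residue R (a' ⟨i, h⟩)) ∈ W₁ := by
    convert huW using 1
    funext i
    by_cases h : i = i₂
    · subst h; rw [dif_pos rfl, hui₂]
    · rw [dif_neg h, ha' ⟨i, h⟩]
  refine ⟨shiftRsop c₁ i₂ a', i₁, i₂, by rw [span_range_shiftRsop, hc₁], hi₁₂,
    IsAdapted.shiftRsop_of_ne hd hc₁ had₁ i₂ hi₁₂ a', isAdapted_shiftRsop hd hc₁ i₂ a' hu⟩

include hd hc in
/-- **`τ = 1` in embedding dimension `3`: a regular system of parameters adapted at both indices `≠ j₀`** ([CoP1]: "we may now choose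
`(y₁, y₂, y₃)` in such a way that `T_x = k(x).Y₃`"). [cite: CossartPiltant2008, Lemma 4.3 (5) (proof)] -/
theorem exists_forall_ne_isAdapted_of_hironakaTauAt_eq_one (hd3 : d = 3) {J : Ideal R} {μ : ℕ}
    (hτ : hironakaTauAt c J μ = 1) :
    ∃ (c' : Fin d → R) (j₀ : Fin d), Ideal.span (Set.range c') = maximalIdeal R ∧
      ∀ i, i ≠ j₀ → IsAdapted c' J μ i := by
  subst hd3
  have hW : 2 ≤ Module.finrank (ResidueField R) (invarianceSpace (ResidueField R)
      (initialForms c J μ : Set (MvPolynomial (Fin 3) (ResidueField R)))) := by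
    have h := hironakaTau_add_finrank_invarianceSpace (ResidueField R)
      (initialForms c J μ : Set (MvPolynomial (Fin 3) (ResidueField R)))
    unfold hironakaTauAt at hτ
    omega
  obtain ⟨c', i₁, i₂, hc', hne, h₁, h₂⟩ := exists_isAdapted_pair_of_two_le_finrank hd hc hW
  obtain ⟨j₀, hj₁, hj₂⟩ := Fin.exists_ne_and_ne_three i₁ i₂
  refine ⟨c', j₀, hc', fun i hi => ?_⟩
  rcases Fin.eq_or_eq_of_ne_three hne hj₁ hj₂ hi with rfl | rfl
  · exact h₁
  · exact h₂

end Regular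

/-! ## At a point of a scheme -/

section Scheme

open AlgebraicGeometry

variable {X : AlgebraicGeometry.Scheme.{u}}

/-- **At a point with regular three-dimensional local ring and `τ_x(J, μ) = 1` there is a regular system of parameters `c` and an index
`j₀` with `c` adapted at every `i ≠ j₀`** — the coordinate input `had` of
`IsBlowup.exists_isRsopPart_line_of_isNear_point_of_stalkTau_eq_one` / `…_of_proj_mem_directrix` (Lemma 4.3 (5) in the tree).
[cite: CossartPiltant2008, Lemma 4.3 (5) (proof)] -/
theorem exists_rsop_forall_ne_isAdapted_of_stalkTau_eq_one (J : X.IdealSheafData) (x : X)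
    [IsRegularLocalRing (X.presheaf.stalk x)] (hd : (maximalIdeal (X.presheaf.stalk x)).spanFinrank = 3) {μ : ℕ}
    (hτ : stalkTau J x μ = 1) :
    ∃ (c : Fin 3 → X.presheaf.stalk x) (j₀ : Fin 3), Ideal.span (Set.range c) = maximalIdeal _ ∧
      ∀ i, i ≠ j₀ → IsAdapted c (stalkIdeal J x) μ i := by
  obtain ⟨c₀, hc₀⟩ := exists_regularSystemOfParameters (R := X.presheaf.stalk x)
  let c : Fin 3 → X.presheaf.stalk x := c₀ ∘ finCongr hd.symm
  have hc : Ideal.span (Set.range c) = maximalIdeal _ := by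
    rw [Set.range_comp, (finCongr hd.symm).surjective.range_eq, Set.image_univ, hc₀]
  have hτc : hironakaTauAt c (stalkIdeal J x) μ = 1 := by
    rw [← stalkTau_eq J x μ hd c hc]; exact hτ
  exact exists_forall_ne_isAdapted_of_hironakaTauAt_eq_one hd hc rfl hτc

end Scheme

end Literature.AlgebraicGeometry.Resolution

end
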